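import Summits.HubbardSuperconductivity.HubbardSuperconductivity.Theorems.ThermalWedgeTwExponentialCeilingOfInertness
import Summits.HubbardSuperconductivity.HubbardSuperconductivity.Theorems.ThermalWedgeTwSourcedInertnessCorrections
import Summits.HubbardSuperconductivity.HubbardSuperconductivity.Theorems.ThermalWedgeTwSourcedInertnessDiscCorrectionSusceptibility

/-!
# Route `ThermalWedge` — the calibration target `TwExponentialCeiling` (stmt-HubbardSuperconductivity-1704)
modulo the two interacting Fermi-liquid laws of the line `temperature-for-source-exchange`

One named handle for graders and planners, composing three files of the tree:

* `twExponentialCeiling_of_inertness` (`…TwExponentialCeilingOfInertness`, p85537):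
  `TwSourcedInertness → TwExponentialCeiling` (the glue, `TwSectorEnergyLowerBound`,
  `TwPureThermalBound`, `TwApproximatingHamiltonian` being theorems);
* `twSourcedInertness_of_corrections` (`…TwSourcedInertnessCorrections`, the registered skeleton's
  composition, p84477): `stub_discCorrection → stub_thermalCorrection → TwSourcedInertness`;
* `stub_discCorrection_of_discSusceptibility` (`…TwSourcedInertnessDiscCorrectionSusceptibility`,
  p86225): the Kubo–Mori–Bogoliubov `d`-wave pair-susceptibility law on the thermal disc implies
  `stub_discCorrection`.

Hence (`twSourcedInertness_of_discSusceptibility_of_thermalCorrection`,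
`twExponentialCeiling_of_discSusceptibility_of_thermalCorrection`): the crux `TwSourcedInertness`
(stmt-1696) and the target `TwExponentialCeiling` (stmt-1704) hold as soon as

  (Sχ) the pair susceptibility `χ_L(β,μ,U,t) = (β/L²)[Re (Q,Q)_{β,H_{L,t}} − (Re⟨Q⟩_{β,H_{L,t}})²]`,
       `Q = Δ_d + Δ_d†`, is `≤ C(1 + log β)` for `|t| ≤ 1/β`, and
  (ST) the interaction correction to the dyadic thermal increment of the PURE torus pressure is
       `≤ C(1 + log β)/β²` (the registered stub `stub_thermalCorrection`, verbatim),

both for every compact `[μ₁,μ₂] ⊂ (−4,0)`, `0 < U ≤ U₀`, `β ≤ e^{a/U}`, eventually in `L` — the two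
Benfatto–Giuliani–Mastropietro-type statements (convergent multiscale expansion of the weakly
repulsive 2D Hubbard model at general filling, with a pair source for (Sχ)) that are not in print.
By `tw_zeroSourceSusceptibility_of_inertness` (`…TwSourcedInertnessZeroSourceResponse`, p89182) the
`t = 0` slice of (Sχ) is conversely implied by the crux. No definition; nothing else is assumed.
-/

set_option linter.dupNamespace false

namespace Summit.HubbardSuperconductivity.HubbardSuperconductivity.Theorems

open Summit.HubbardSuperconductivity.HubbardSuperconductivity.Theses.ThermalWedge
open scoped Matrix

/-- **The crux modulo the two Fermi-liquid laws.** (Sχ) the KMB `d`-wave pair susceptibility of the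
sourced torus Gibbs state is `≤ C(1 + log β)` on the thermal disc `|t| ≤ 1/β`, and (ST) the
interaction correction to the dyadic thermal increment of the pure torus pressure is
`≤ C(1 + log β)/β²` (registered stub `stub_thermalCorrection`), together imply `TwSourcedInertness`
(composition of `stub_discCorrection_of_discSusceptibility` and `twSourcedInertness_of_corrections`). -/
theorem twSourcedInertness_of_discSusceptibility_of_thermalCorrection
    (hχ : ∀ μ₁ μ₂ : ℝ, -4 < μ₁ → μ₁ ≤ μ₂ → μ₂ < 0 → ∃ U₀ a C : ℝ, 0 < U₀ ∧ 0 < a ∧ 0 < C ∧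
      ∀ U : ℝ, 0 < U → U ≤ U₀ → ∀ β : ℝ, 1 ≤ β → β ≤ Real.exp (a / U) → ∀ μ ∈ Set.Icc μ₁ μ₂,
        ∃ L₀ : ℕ, ∀ (L : ℕ) [NeZero L], L₀ ≤ L → ∀ t : ℝ, |t| ≤ 1 / β →
          β / (L : ℝ) ^ 2 *
            ((Matrix.duhamel β
                (Literature.MathematicalPhysics.QuantumLattice.dWaveSourceTorus L U μ t)
                (Literature.MathematicalPhysics.QuantumLattice.pairField
                  Literature.MathematicalPhysics.QuantumLattice.dWaveFormFactor L +
                  (Literature.MathematicalPhysics.QuantumLattice.pairField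
                    Literature.MathematicalPhysics.QuantumLattice.dWaveFormFactor L)ᴴ)
                (Literature.MathematicalPhysics.QuantumLattice.pairField
                  Literature.MathematicalPhysics.QuantumLattice.dWaveFormFactor L +
                  (Literature.MathematicalPhysics.QuantumLattice.pairField
                    Literature.MathematicalPhysics.QuantumLattice.dWaveFormFactor L)ᴴ)).re -
              (Matrix.gibbsState β
                (Literature.MathematicalPhysics.QuantumLattice.dWaveSourceTorus L U μ t)
                (Literature.MathematicalPhysics.QuantumLattice.pairField
                  Literature.MathematicalPhysics.QuantumLattice.dWaveFormFactor L +
                  (Literature.MathematicalPhysics.QuantumLattice.pairField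
                    Literature.MathematicalPhysics.QuantumLattice.dWaveFormFactor L)ᴴ)).re ^ 2) ≤
            C * (1 + Real.log β))
    (hT : ∀ μ₁ μ₂ : ℝ, -4 < μ₁ → μ₁ ≤ μ₂ → μ₂ < 0 → ∃ U₀ a C : ℝ, 0 < U₀ ∧ 0 < a ∧ 0 < C ∧
      ∀ U : ℝ, 0 < U → U ≤ U₀ → ∀ β : ℝ, 2 ≤ β → β ≤ Real.exp (a / U) → ∀ μ ∈ Set.Icc μ₁ μ₂,
        ∃ L₀ : ℕ, ∀ (L : ℕ) [NeZero L], L₀ ≤ L →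
          (Real.log (Matrix.partitionFn (β / 2)
              (Literature.MathematicalPhysics.QuantumLattice.hubbardTorusWith 2 L 1 U μ)).re /
                (β / 2 * (L : ℝ) ^ 2) -
            Real.log (Matrix.partitionFn β
              (Literature.MathematicalPhysics.QuantumLattice.hubbardTorusWith 2 L 1 U μ)).re /
                (β * (L : ℝ) ^ 2)) -
          (Real.log (Matrix.partitionFn (β / 2)
              (Literature.MathematicalPhysics.QuantumLattice.hubbardTorusWith 2 L 1 0 μ)).re /
                (β / 2 * (L : ℝ) ^ 2) -
            Real.log (Matrix.partitionFn β
              (Literature.MathematicalPhysics.QuantumLattice.hubbardTorusWith 2 L 1 0 μ)).re /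
                (β * (L : ℝ) ^ 2)) ≤
            C * (1 + Real.log β) / β ^ 2) :
    TwSourcedInertness :=
  twSourcedInertness_of_corrections (stub_discCorrection_of_discSusceptibility hχ) hT

/-- **The calibration target modulo the two Fermi-liquid laws.** Under (Sχ) and (ST) as above,
`TwExponentialCeiling` holds: the exponential ceiling `e^{−a/U}`-type bound on the every-ground-state
`d`-wave order of the pure 2D Hubbard torus at weak coupling is reduced to the pair-susceptibility
law on the thermal disc and the thermal-correction law of the pure pressure
(`twExponentialCeiling_of_inertness` after the previous theorem). -/
theorem twExponentialCeiling_of_discSusceptibility_of_thermalCorrection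
    (hχ : ∀ μ₁ μ₂ : ℝ, -4 < μ₁ → μ₁ ≤ μ₂ → μ₂ < 0 → ∃ U₀ a C : ℝ, 0 < U₀ ∧ 0 < a ∧ 0 < C ∧
      ∀ U : ℝ, 0 < U → U ≤ U₀ → ∀ β : ℝ, 1 ≤ β → β ≤ Real.exp (a / U) → ∀ μ ∈ Set.Icc μ₁ μ₂,
        ∃ L₀ : ℕ, ∀ (L : ℕ) [NeZero L], L₀ ≤ L → ∀ t : ℝ, |t| ≤ 1 / β →
          β / (L : ℝ) ^ 2 *
            ((Matrix.duhamel β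
                (Literature.MathematicalPhysics.QuantumLattice.dWaveSourceTorus L U μ t)
                (Literature.MathematicalPhysics.QuantumLattice.pairField
                  Literature.MathematicalPhysics.QuantumLattice.dWaveFormFactor L +
                  (Literature.MathematicalPhysics.QuantumLattice.pairField
                    Literature.MathematicalPhysics.QuantumLattice.dWaveFormFactor L)ᴴ)
                (Literature.MathematicalPhysics.QuantumLattice.pairField
                  Literature.MathematicalPhysics.QuantumLattice.dWaveFormFactor L +
                  (Literature.MathematicalPhysics.QuantumLattice.pairField
                    Literature.MathematicalPhysics.QuantumLattice.dWaveFormFactor L)ᴴ)).re -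
              (Matrix.gibbsState β
                (Literature.MathematicalPhysics.QuantumLattice.dWaveSourceTorus L U μ t)
                (Literature.MathematicalPhysics.QuantumLattice.pairField
                  Literature.MathematicalPhysics.QuantumLattice.dWaveFormFactor L +
                  (Literature.MathematicalPhysics.QuantumLattice.pairField
                    Literature.MathematicalPhysics.QuantumLattice.dWaveFormFactor L)ᴴ)).re ^ 2) ≤
            C * (1 + Real.log β))
    (hT : ∀ μ₁ μ₂ : ℝ, -4 < μ₁ → μ₁ ≤ μ₂ → μ₂ < 0 → ∃ U₀ a C : ℝ, 0 < U₀ ∧ 0 < a ∧ 0 < C ∧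
      ∀ U : ℝ, 0 < U → U ≤ U₀ → ∀ β : ℝ, 2 ≤ β → β ≤ Real.exp (a / U) → ∀ μ ∈ Set.Icc μ₁ μ₂,
        ∃ L₀ : ℕ, ∀ (L : ℕ) [NeZero L], L₀ ≤ L →
          (Real.log (Matrix.partitionFn (β / 2)
              (Literature.MathematicalPhysics.QuantumLattice.hubbardTorusWith 2 L 1 U μ)).re /
                (β / 2 * (L : ℝ) ^ 2) -
            Real.log (Matrix.partitionFn β
              (Literature.MathematicalPhysics.QuantumLattice.hubbardTorusWith 2 L 1 U μ)).re /
                (β * (L : ℝ) ^ 2)) -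
          (Real.log (Matrix.partitionFn (β / 2)
              (Literature.MathematicalPhysics.QuantumLattice.hubbardTorusWith 2 L 1 0 μ)).re /
                (β / 2 * (L : ℝ) ^ 2) -
            Real.log (Matrix.partitionFn β
              (Literature.MathematicalPhysics.QuantumLattice.hubbardTorusWith 2 L 1 0 μ)).re /
                (β * (L : ℝ) ^ 2)) ≤
            C * (1 + Real.log β) / β ^ 2) :
    TwExponentialCeiling :=
  twExponentialCeiling_of_inertness
    (twSourcedInertness_of_discSusceptibility_of_thermalCorrection hχ hT)

end Summit.HubbardSuperconductivity.HubbardSuperconductivity.Theorems
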